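import Summits.ValiantsHypothesis.ValiantsHypothesis.Theorems.LacunarySymmetroidMatrixDescartesCensusTropicalKLawStatic
import Summits.ValiantsHypothesis.ValiantsHypothesis.Theorems.LacunarySymmetroidMatrixDescartesCensusTropicalKLawSlopes

/-!
# Route «KPlusLogSqLaw», crux `TropicalB` (stmt-ValiantsHypothesis-19771) — lines of the affine plane `(ZMod p)²`: DEFINITIONS

HONEST FRAMING.  Definitions-only file (D-0009) of the helper chain `…TropicalBAffinePlane` / `…TropicalBAffineSkeleton` toward the
registered stubs `stub_tropThin` / `stub_tropFat` of `Cruxes/TropicalB/Lines/birth.lean` (crux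
`Summit.ValiantsHypothesis.ValiantsHypothesis.Theses.KPlusLogSqLaw.TropicalB`, item stmt-ValiantsHypothesis-19771, route KPlusLogSqLaw;
cell `pub-symmetroid`, seat val-sym-trop-p4 g9, 2026-08-27).  It names the `p² + p` LINES of the affine plane over `ZMod p` as finite
cell sets and proves the two membership lemmas; nothing else.  A proof gadget, not a notion of the route: no statement of the route
depends on it.  Nothing here bears on `TropicalB`, `WeakLifting`, DoorA26 / DoorA34, `MatrixDescartes` (stmt-ValiantsHypothesis-18050)
or VP ≠ VNP.

Cells are `ZMod p × ZMod p` (row, column).  Line indices: `(ZMod p × ZMod p) ⊕ ZMod p`; `inl (γ, δ)` is the GRAPH LINE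
`{(γ·b + δ, b) : b}` — for `γ ≠ 0` the graph (set of cells) of the affine permutation `b ↦ γ b + δ`, for `γ = 0` the row `δ` — and
`inr c` is the column `{(a, c) : a}`. [folklore]
-/

set_option linter.dupNamespace false
set_option autoImplicit false

namespace Summit.ValiantsHypothesis.ValiantsHypothesis.Theorems.KPlusLogSqLaw

namespace AffinePlane

open Finset

section Lines

variable (p : ℕ) [Fact p.Prime]

/-- the line with index `ℓ`: `inl (γ, δ)` ↦ graph line `{(γ b + δ, b)}`, `inr c` ↦ column `c`. [folklore] -/
def line : (ZMod p × ZMod p) ⊕ ZMod p → Finset (ZMod p × ZMod p)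
  | .inl gd => univ.image fun b : ZMod p => (gd.1 * b + gd.2, b)
  | .inr c => univ.image fun a : ZMod p => (a, c)

/-- membership in a graph line. [folklore] -/
theorem mem_line_inl {γ δ : ZMod p} {x : ZMod p × ZMod p} :
    x ∈ line p (.inl (γ, δ)) ↔ x.1 = γ * x.2 + δ := by
  unfold line
  simp only [mem_image, mem_univ, true_and]
  constructor
  · rintro ⟨b, hb⟩
    rw [← hb]
  · intro h
    exact ⟨x.2, by rw [← h]⟩

/-- membership in a column line. [folklore] -/
theorem mem_line_inr {c : ZMod p} {x : ZMod p × ZMod p} : x ∈ line p (.inr c) ↔ x.2 = c := by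
  unfold line
  simp only [mem_image, mem_univ, true_and]
  constructor
  · rintro ⟨a, ha⟩
    rw [← ha]
  · intro h
    exact ⟨x.1, by rw [← h]⟩

end Lines

end AffinePlane

end Summit.ValiantsHypothesis.ValiantsHypothesis.Theorems.KPlusLogSqLaw
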